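import Summits.Langlands.Langlands.Theorems.QuarterDeficit1951IcosahedralSupplyDoudMooreField
import Literature.NumberTheory.GaloisRepresentations.AbsGaloisOuterConj
import Summits.Langlands.Langlands.Theorems.DedekindQuotient1951DoudMoorePermutationSupplyGroupTheory

/-!
# Route `DedekindQuotient1951` (Langlands) — support `DoudMoorePermutationSupply`: the quintic field

The Doud–Moore quintic `f = x⁵ − x⁴ − 780x³ + 9911x² − 24208x + 15952` and its root field,
from the landed stubs of route `QuarterDeficit1951` (`stub_dmGaloisDatum`: the five roots
`θ i ∈ ℤ̄` and the permutation representation `e₀ : Γ_ℚ → S₅`; `stub_dmUnramified`: inertia away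
from `1951` fixes the roots; `stub_dmLocal1951`: an inertia element of order `5` at `1951`;
`stub_dmEvenOrderThree`: an element of order `3`):

* `dm_rootDatum` — the root datum, with elements of order `5` and `3` in the image of `e₀`;
* `dm_smul_transitive` — `Γ_ℚ` is transitive on the roots (the order-`5` element is a `5`-cycle),
  hence `natDegree_minpoly_dm` — `f` is the minimal polynomial of a root (`[ℚ(θ) : ℚ] = 5`) and
  `exists_dmField` — a number field `K = ℚ(θ)` of degree `5` generated by a root;
* for any number field `K` generated by a root `θ_K`: `mem_range_absGaloisRestrict_iff_smul_gen`
  (`res(Γ_K) ≤ Γ_ℚ` is the stabiliser of the root `e(θ_K) ∈ ℚ̄`, `e` the tree's `absEmbedding`),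
  `forall_conj_mem_range_iff` (`τ` acts trivially on `Γ_ℚ / res(Γ_K)` iff `e₀ τ = 1`), and
  `inertia_le_range_absGaloisRestrict_dm` (every inertia group at a prime `≠ 1951` lies in
  `res(Γ_K)`: `K` is unramified away from `1951`).

References: D. Doud, M. W. Moore, *Even icosahedral Galois representations of prime conductor*,
J. Number Theory 118 (2006), §4; J. Neukirch, *Algebraic Number Theory* (1999), I §9.
-/

set_option linter.dupNamespace false

noncomputable section

open scoped NumberField IntermediateField
open Field IsDedekindDomain Polynomial
open Literature.NumberTheory.GaloisRepresentations

namespace Summit.Langlands.Langlands.Theorems.DedekindQuotient1951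

/-- Ring homomorphisms commute with the evaluation of the Doud–Moore quintic. [folklore] -/
theorem map_dmP {F A B : Type*} [Ring A] [Ring B] [FunLike F A B] [RingHomClass F A B]
    (g : F) (x : A) :
    g (x ^ 5 - x ^ 4 - 780 * x ^ 3 + 9911 * x ^ 2 - 24208 * x + 15952) =
      g x ^ 5 - g x ^ 4 - 780 * g x ^ 3 + 9911 * g x ^ 2 - 24208 * g x + 15952 := by
  simp only [map_sub, map_add, map_mul, map_pow, map_ofNat]

/-- An element of order `5` in `S₅` exists in the image of `e₀` iff… (auxiliary): an element of
`Subgroup.zpowers g` of the form `e₀ σ` with `σ` in a subgroup mapping onto it. [folklore] -/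
theorem exists_apply_eq_of_map_eq_zpowers {G H : Type*} [Group G] [Group H] (f : G →* H)
    (S : Subgroup G) (g : H) (h : S.map f = Subgroup.zpowers g) : ∃ σ ∈ S, f σ = g := by
  have hg : g ∈ S.map f := by rw [h]; exact Subgroup.mem_zpowers g
  exact Subgroup.mem_map.mp hg

/-- **The root datum of the Doud–Moore quintic.**  Five distinct roots `θ i ∈ ℤ̄ ⊆ ℚ̄` exhausting
the roots in `ℚ̄`, the permutation representation `e₀ : Γ_ℚ → S₅` on them, triviality of inertia
away from `1951` on the roots, and elements of order `5` (inertia at `1951`) and `3` in the image.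
[cite: DoudMoore2006, §4 (Table, p = 1951)] -/
theorem dm_rootDatum :
    ∃ (θ : Fin 5 → absIntegers (𝓞 ℚ) ℚ) (e₀ : absoluteGaloisGroup ℚ →* Equiv.Perm (Fin 5)),
      (∀ i, θ i ^ 5 - θ i ^ 4 - 780 * θ i ^ 3 + 9911 * θ i ^ 2 - 24208 * θ i + 15952 = 0) ∧
      Function.Injective θ ∧
      (∀ x : AlgebraicClosure ℚ,
        x ^ 5 - x ^ 4 - 780 * x ^ 3 + 9911 * x ^ 2 - 24208 * x + 15952 = 0 → ∃ i, x = θ i) ∧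
      (∀ (σ : absoluteGaloisGroup ℚ) (i : Fin 5), σ • θ i = θ (e₀ σ i)) ∧
      (∀ v : HeightOneSpectrum (𝓞 ℚ), v.residueCard ≠ 1951 →
        ∀ 𝔓 ∈ v.primesAbove, ∀ σ ∈ 𝔓.inertia (absoluteGaloisGroup ℚ), ∀ i, σ • θ i = θ i) ∧
      (∃ σ : absoluteGaloisGroup ℚ, orderOf (e₀ σ) = 5) ∧
      (∃ σ : absoluteGaloisGroup ℚ, orderOf (e₀ σ) = 3) := by
  classical
  obtain ⟨θ, e₀, hroot, hinj, hall, he₀, hopen, -⟩ := QuarterDeficit1951.stub_dmGaloisDatum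
  have hunr := QuarterDeficit1951.stub_dmUnramified θ hroot hinj hall
  have hloc := QuarterDeficit1951.stub_dmLocal1951 θ hroot hinj hall e₀ he₀
  obtain ⟨-, σ₃, hσ₃1, hσ₃⟩ :=
    QuarterDeficit1951.stub_dmEvenOrderThree θ hroot hinj hall e₀ he₀ hopen hunr hloc
  refine ⟨θ, e₀, hroot, hinj, hall, he₀, hunr, ?_, σ₃, ?_⟩
  · -- the place `(1951)` and an inertia element of order `5`
    have hp : Nat.Prime 1951 := by norm_num
    set v₀ : HeightOneSpectrum (𝓞 ℚ) :=
      (Rat.HeightOneSpectrum.primesEquiv (R := 𝓞 ℚ)).symm ⟨1951, hp⟩ with hv₀def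
    have hv₀ : ((1951 : ℕ) : 𝓞 ℚ) ∈ v₀.asIdeal :=
      (Literature.NumberTheory.EllipticCurves.natCast_mem_asIdeal_iff_eq_primesEquiv_symm v₀
        hp).mpr rfl
    have hv₀res : v₀.residueCard = 1951 := Rat.residueCard_eq_of_natCast_mem hp hv₀
    obtain ⟨𝔓₀, h𝔓₀⟩ := HeightOneSpectrum.primesAbove_nonempty v₀
    obtain ⟨g₅, hg₅, hI₅, -⟩ := hloc v₀ hv₀res 𝔓₀ h𝔓₀
    obtain ⟨σ₅, -, hσ₅⟩ := exists_apply_eq_of_map_eq_zpowers e₀ _ g₅ hI₅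
    exact ⟨σ₅, by rw [hσ₅, hg₅]⟩
  · haveI : Fact (Nat.Prime 3) := ⟨by norm_num⟩
    exact orderOf_eq_prime hσ₃ hσ₃1

section Roots

variable {θ : Fin 5 → absIntegers (𝓞 ℚ) ℚ} {e₀ : absoluteGaloisGroup ℚ →* Equiv.Perm (Fin 5)}

/-- The action on the roots, inside `ℚ̄`. [folklore] -/
theorem dm_smul_coe (he₀ : ∀ (σ : absoluteGaloisGroup ℚ) (i : Fin 5), σ • θ i = θ (e₀ σ i))
    (σ : absoluteGaloisGroup ℚ) (i : Fin 5) :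
    σ • (θ i : AlgebraicClosure ℚ) = (θ (e₀ σ i) : AlgebraicClosure ℚ) := by
  rw [← integralClosure.coe_smul, he₀]

/-- **`Γ_ℚ` is transitive on the roots** (the image of `e₀` contains a `5`-cycle). [folklore] -/
theorem dm_smul_transitive (he₀ : ∀ (σ : absoluteGaloisGroup ℚ) (i : Fin 5), σ • θ i = θ (e₀ σ i))
    (h5 : ∃ σ : absoluteGaloisGroup ℚ, orderOf (e₀ σ) = 5) (i j : Fin 5) :
    ∃ x : absoluteGaloisGroup ℚ, x • (θ i : AlgebraicClosure ℚ) = θ j := by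
  obtain ⟨σ, hσ⟩ := h5
  obtain ⟨k, hk⟩ := exists_pow_apply_eq_of_orderOf_eq_five hσ i j
  exact ⟨σ ^ k, by rw [dm_smul_coe he₀, map_pow, hk]⟩

/-- **The Doud–Moore quintic is irreducible**: the minimal polynomial of a root has degree `5`
(all five roots are `Γ_ℚ`-conjugate). [cite: DoudMoore2006, §4 (Table, p = 1951)] -/
theorem natDegree_minpoly_dm
    (hroot : ∀ i, θ i ^ 5 - θ i ^ 4 - 780 * θ i ^ 3 + 9911 * θ i ^ 2 - 24208 * θ i + 15952 = 0)
    (hinj : Function.Injective θ)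
    (he₀ : ∀ (σ : absoluteGaloisGroup ℚ) (i : Fin 5), σ • θ i = θ (e₀ σ i))
    (h5 : ∃ σ : absoluteGaloisGroup ℚ, orderOf (e₀ σ) = 5) (i₀ : Fin 5) :
    (minpoly ℚ (θ i₀ : AlgebraicClosure ℚ)).natDegree = 5 := by
  classical
  set α : AlgebraicClosure ℚ := ((θ i₀ : absIntegers (𝓞 ℚ) ℚ) : AlgebraicClosure ℚ) with hα
  have hαroot : α ^ 5 - α ^ 4 - 780 * α ^ 3 + 9911 * α ^ 2 - 24208 * α + 15952 = 0 := by
    have h := congrArg (Subtype.val : absIntegers (𝓞 ℚ) ℚ → AlgebraicClosure ℚ) (hroot i₀)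
    rw [ZeroMemClass.coe_zero] at h
    push_cast at h
    exact h
  set f : ℚ[X] := X ^ 5 - X ^ 4 - 780 * X ^ 3 + 9911 * X ^ 2 - 24208 * X + 15952 with hf
  have hfmon : f.Monic := by rw [hf]; monicity!
  have hfdeg : f.natDegree = 5 := by rw [hf]; compute_degree!
  have hfα : aeval α f = 0 := by
    simp only [hf, map_add, map_sub, map_mul, map_pow, aeval_X, map_ofNat]
    exact hαroot
  have hint : IsIntegral ℚ α := ⟨f, hfmon, by rwa [aeval_def] at hfα⟩
  apply le_antisymm
  · rw [← hfdeg]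
    exact natDegree_le_of_dvd (minpoly.dvd ℚ α hfα) hfmon.ne_zero
  · -- the five roots are roots of the minimal polynomial
    set p : (AlgebraicClosure ℚ)[X] := (minpoly ℚ α).map (algebraMap ℚ (AlgebraicClosure ℚ))
      with hp
    have hne : p ≠ 0 := ((minpoly.monic hint).map _).ne_zero
    have hpdeg : p.natDegree = (minpoly ℚ α).natDegree := natDegree_map _
    set S : Finset (AlgebraicClosure ℚ) := Finset.univ.image fun i => (θ i : AlgebraicClosure ℚ)
    have hS : S.card = 5 := by
      rw [Finset.card_image_of_injective _ (fun i j h => hinj (Subtype.val_injective h)),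
        Finset.card_univ, Fintype.card_fin]
    have hsub : S ⊆ p.roots.toFinset := by
      intro x hx
      obtain ⟨i, -, rfl⟩ := Finset.mem_image.mp hx
      obtain ⟨σ, hσ⟩ := dm_smul_transitive he₀ h5 i₀ i
      rw [Multiset.mem_toFinset, mem_roots hne, IsRoot.def, hp, eval_map, ← aeval_def, ← hσ,
        absoluteGaloisGroup.smul_def, ← AlgEquiv.coe_toAlgHom, aeval_algHom_apply, minpoly.aeval,
        map_zero]
    calc 5 = S.card := hS.symm
      _ ≤ p.roots.toFinset.card := Finset.card_le_card hsub
      _ ≤ p.roots.card := Multiset.toFinset_card_le _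
      _ ≤ p.natDegree := card_roots' _
      _ = (minpoly ℚ α).natDegree := hpdeg

end Roots

/-- **A number field `K = ℚ(θ)` of degree `5` generated by a root of the Doud–Moore quintic**
(the subfield `ℚ(θ₀) ⊆ ℚ̄`). [cite: DoudMoore2006, §4 (Table, p = 1951)] -/
theorem exists_dmField (α : AlgebraicClosure ℚ)
    (hα : α ^ 5 - α ^ 4 - 780 * α ^ 3 + 9911 * α ^ 2 - 24208 * α + 15952 = 0)
    (hdeg : (minpoly ℚ α).natDegree = 5) :
    ∃ (K : Type) (_ : Field K) (_ : NumberField K) (θK : K),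
      θK ^ 5 - θK ^ 4 - 780 * θK ^ 3 + 9911 * θK ^ 2 - 24208 * θK + 15952 = 0 ∧
      IntermediateField.adjoin ℚ ({θK} : Set K) = ⊤ ∧ Module.finrank ℚ K = 5 := by
  have hint : IsIntegral ℚ α := by
    refine ⟨X ^ 5 - X ^ 4 - 780 * X ^ 3 + 9911 * X ^ 2 - 24208 * X + 15952, by monicity!, ?_⟩
    simp only [eval₂_add, eval₂_sub, eval₂_mul, eval₂_pow, eval₂_X, eval₂_ofNat]
    exact hα
  haveI : FiniteDimensional ℚ (ℚ⟮α⟯ : IntermediateField ℚ (AlgebraicClosure ℚ)) :=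
    IntermediateField.adjoin.finiteDimensional hint
  haveI hK : NumberField (ℚ⟮α⟯ : IntermediateField ℚ (AlgebraicClosure ℚ)) := NumberField.mk
  refine ⟨ℚ⟮α⟯, inferInstance, hK, IntermediateField.AdjoinSimple.gen ℚ α, ?_, ?_, ?_⟩
  · apply Subtype.val_injective
    have h := IntermediateField.AdjoinSimple.coe_gen ℚ α
    push_cast
    rw [h]
    exact hα
  · have h := IntermediateField.lift_injective _
      (show IntermediateField.lift
          (IntermediateField.adjoin ℚ {IntermediateField.AdjoinSimple.gen ℚ α}) =
          IntermediateField.lift (F := ℚ⟮α⟯) ⊤ by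
        rw [IntermediateField.lift_adjoin_simple, IntermediateField.lift_top,
          IntermediateField.AdjoinSimple.coe_gen])
    -- the two `ℚ`-algebra structures on the subfield agree
    have hinst : (DivisionRing.toRatAlgebra :
        Algebra ℚ (ℚ⟮α⟯ : IntermediateField ℚ (AlgebraicClosure ℚ))) =
        (ℚ⟮α⟯ : IntermediateField ℚ (AlgebraicClosure ℚ)).algebra' := Subsingleton.elim _ _
    rw [hinst]
    exact h
  · rw [IntermediateField.adjoin.finrank hint, hdeg]

/-! ### A number field generated by a root: `res(Γ_K)` and the roots -/

section Generated

variable {K : Type*} [Field K] [NumberField K] {θK : K}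

/-- The image `e(θ_K) ∈ ℚ̄` of a root `θ_K ∈ K` of the quintic under the tree's embedding
`e = absEmbedding ℚ K` is a root. [folklore] -/
theorem absEmbedding_gen_root
    (hθK : θK ^ 5 - θK ^ 4 - 780 * θK ^ 3 + 9911 * θK ^ 2 - 24208 * θK + 15952 = 0) :
    absEmbedding ℚ K θK ^ 5 - absEmbedding ℚ K θK ^ 4 - 780 * absEmbedding ℚ K θK ^ 3 +
      9911 * absEmbedding ℚ K θK ^ 2 - 24208 * absEmbedding ℚ K θK + 15952 = 0 := by
  rw [← map_dmP, hθK, map_zero]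

/-- **`res(Γ_K)` is the stabiliser of `e(θ_K)`**: for `K = ℚ(θ_K)`, an element of `Γ_ℚ` is a
restriction from `Γ_K` iff it fixes the root `e(θ_K) ∈ ℚ̄` (`res(Γ_K)` is the pointwise fixer of
`e(K)`, `mem_range_absGaloisRestrict_iff_smul_absEmbedding`, and two `ℚ`-algebra maps out of
`K = ℚ[θ_K]` agreeing at `θ_K` agree). [folklore] -/
theorem mem_range_absGaloisRestrict_iff_smul_gen (hgen : IntermediateField.adjoin ℚ ({θK} : Set K) = ⊤)
    (g : absoluteGaloisGroup ℚ) :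
    g ∈ (absGaloisRestrict ℚ K).range ↔ g • absEmbedding ℚ K θK = absEmbedding ℚ K θK := by
  rw [mem_range_absGaloisRestrict_iff_smul_absEmbedding]
  refine ⟨fun h => h θK, fun h x => ?_⟩
  -- the two algebra maps `e` and `g ∘ e` agree on the generator, hence everywhere
  set φ : K →ₐ[ℚ] AlgebraicClosure ℚ :=
    (absoluteGaloisGroup.toAlgEquiv ℚ g).toAlgHom.comp (absEmbedding ℚ K) with hφ
  have hφx : ∀ y, φ y = g • absEmbedding ℚ K y := fun y => rfl
  have hint : IsIntegral ℚ θK := Algebra.IsIntegral.isIntegral θK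
  have hadj : Algebra.adjoin ℚ ({θK} : Set K) = ⊤ := by
    rw [← IntermediateField.adjoin_simple_toSubalgebra_of_isAlgebraic hint.isAlgebraic, hgen,
      IntermediateField.top_toSubalgebra]
  have hle := AlgHom.adjoin_le_equalizer φ (absEmbedding ℚ K)
    (s := ({θK} : Set K)) (fun y hy => by
      rw [Set.mem_singleton_iff.mp hy]
      exact h)
  rw [hadj, top_le_iff] at hle
  have hx : x ∈ AlgHom.equalizer φ (absEmbedding ℚ K) := hle ▸ Algebra.mem_top
  rw [AlgHom.mem_equalizer] at hx
  exact (hφx x).symm.trans hx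

variable {θ : Fin 5 → absIntegers (𝓞 ℚ) ℚ} {e₀ : absoluteGaloisGroup ℚ →* Equiv.Perm (Fin 5)}

/-- `e(θ_K)` is one of the five roots `θ i`. [folklore] -/
theorem exists_absEmbedding_gen_eq
    (hall : ∀ x : AlgebraicClosure ℚ,
      x ^ 5 - x ^ 4 - 780 * x ^ 3 + 9911 * x ^ 2 - 24208 * x + 15952 = 0 → ∃ i, x = θ i)
    (hθK : θK ^ 5 - θK ^ 4 - 780 * θK ^ 3 + 9911 * θK ^ 2 - 24208 * θK + 15952 = 0) :
    ∃ i₀, absEmbedding ℚ K θK = θ i₀ :=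
  hall _ (absEmbedding_gen_root hθK)

/-- **`τ ∈ Γ_ℚ` acts trivially on `Γ_ℚ / res(Γ_K)` iff it fixes all five roots** (`e₀ τ = 1`):
the conjugates `x • e(θ_K)` of the root `e(θ_K)` are all the roots (transitivity). [folklore] -/
theorem forall_conj_mem_range_iff (hinj : Function.Injective θ)
    (hall : ∀ x : AlgebraicClosure ℚ,
      x ^ 5 - x ^ 4 - 780 * x ^ 3 + 9911 * x ^ 2 - 24208 * x + 15952 = 0 → ∃ i, x = θ i)
    (he₀ : ∀ (σ : absoluteGaloisGroup ℚ) (i : Fin 5), σ • θ i = θ (e₀ σ i))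
    (h5 : ∃ σ : absoluteGaloisGroup ℚ, orderOf (e₀ σ) = 5)
    (hθK : θK ^ 5 - θK ^ 4 - 780 * θK ^ 3 + 9911 * θK ^ 2 - 24208 * θK + 15952 = 0)
    (hgen : IntermediateField.adjoin ℚ ({θK} : Set K) = ⊤) (τ : absoluteGaloisGroup ℚ) :
    (∀ x : absoluteGaloisGroup ℚ, x⁻¹ * τ * x ∈ (absGaloisRestrict ℚ K).range) ↔ e₀ τ = 1 := by
  obtain ⟨i₀, hi₀⟩ := exists_absEmbedding_gen_eq hall hθK
  simp only [mem_range_absGaloisRestrict_iff_smul_gen hgen, hi₀, mul_smul]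
  constructor
  · intro h
    ext i
    obtain ⟨x, hx⟩ := dm_smul_transitive he₀ h5 i₀ i
    have h1 := congrArg (x • ·) (h x)
    simp only [smul_inv_smul, hx] at h1
    rw [dm_smul_coe he₀] at h1
    exact congrArg Fin.val (hinj (Subtype.val_injective h1))
  · intro h x
    rw [dm_smul_coe he₀, dm_smul_coe he₀, h, Equiv.Perm.coe_one, id_eq, ← dm_smul_coe he₀,
      inv_smul_smul]

/-- **`K = ℚ(θ)` is unramified away from `1951`, in Galois form**: every inertia group of `Γ_ℚ` at
a prime of residue characteristic `≠ 1951` lies in `res(Γ_K)` (inertia fixes the roots,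
`stub_dmUnramified`, in particular `e(θ_K)`). [cite: DoudMoore2006, §4 (Table, p = 1951)] -/
theorem inertia_le_range_absGaloisRestrict_dm
    (hall : ∀ x : AlgebraicClosure ℚ,
      x ^ 5 - x ^ 4 - 780 * x ^ 3 + 9911 * x ^ 2 - 24208 * x + 15952 = 0 → ∃ i, x = θ i)
    (hunr : ∀ v : HeightOneSpectrum (𝓞 ℚ), v.residueCard ≠ 1951 →
      ∀ 𝔓 ∈ v.primesAbove, ∀ σ ∈ 𝔓.inertia (absoluteGaloisGroup ℚ), ∀ i, σ • θ i = θ i)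
    (hθK : θK ^ 5 - θK ^ 4 - 780 * θK ^ 3 + 9911 * θK ^ 2 - 24208 * θK + 15952 = 0)
    (hgen : IntermediateField.adjoin ℚ ({θK} : Set K) = ⊤)
    {v : HeightOneSpectrum (𝓞 ℚ)} (hv : v.residueCard ≠ 1951) :
    ∀ 𝔓 ∈ v.primesAbove, 𝔓.inertia (absoluteGaloisGroup ℚ) ≤ (absGaloisRestrict ℚ K).range := by
  intro 𝔓 h𝔓 σ hσ
  obtain ⟨i₀, hi₀⟩ := exists_absEmbedding_gen_eq hall hθK
  rw [mem_range_absGaloisRestrict_iff_smul_gen hgen, hi₀, ← integralClosure.coe_smul,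
    hunr v hv 𝔓 h𝔓 σ hσ i₀]

end Generated

end Summit.Langlands.Langlands.Theorems.DedekindQuotient1951

end
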